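import Literature.Probability.Divergences.DonskerVaradhan
import Literature.Probability.Divergences.KLDivConvexity
import Mathlib.InformationTheory.KullbackLeibler.Basic
import Mathlib.MeasureTheory.Integral.IntervalIntegral.Basic
import Mathlib.MeasureTheory.Integral.Prod

/-!
# Time-averaged law of a measurable flow — line `FirstLemma` (idea `kifer-compactification`),
crux stmt-AtomisticToContinuum-14135 `AntiMazurCoboundaries.CorrectorPressureDecay`

Registered stub `stub_timeAveragedLaw` of the lead's skeleton
`Cruxes/CorrectorPressureDecay/Lines/FirstLemma.lean` (namespace
`Summit.AtomisticToContinuum.HydrodynamicLimit.Theorems.KiferCompactification`), proved verbatim.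

TIME-AVERAGED LAW (abstract): for a jointly measurable family `Ψ : ℝ × X → X`, a probability law `μ` on `X`
and a window `h > 0`, let `U := (ENNReal.ofReal h⁻¹) • volume.restrict (Ioc 0 h)` be the uniform
probability on `(0, h]` and `μ̄ := Ψ_# (U ⊗ μ)` the time-averaged push-forward. Then
* `μ̄` is a probability measure;
* `∫ f dμ̄ = h⁻¹ ∫₀ʰ ∫ f (Ψ (t, x)) dμ dt` for every bounded measurable `f` (`integral_map`, Fubini on the
  product of the finite measure `U` with `μ`, `integral_smul_measure`, `intervalIntegral.integral_of_le`);
* ENTROPY DOES NOT INCREASE UNDER TIME AVERAGING: if a probability law `ν` is preserved by every `Ψ_t`, then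
  `KL(μ̄ ‖ ν) ≤ KL(μ ‖ ν)`. Proof via the two Donsker–Varadhan halves of the tree
  (`Literature.Probability.Divergences.integral_le_toReal_klDiv_add_log`, easy half, applied to `ψ ∘ Ψ_t`
  together with the invariance `∫ e^{ψ ∘ Ψ_t} dν = ∫ e^ψ dν`; then averaged in `t` against `U` and fed to the
  hard half `Literature.Probability.Divergences.klDiv_le_of_forall_integral_le`).
-/

noncomputable section

open MeasureTheory ProbabilityTheory Set

namespace Summit.AtomisticToContinuum.HydrodynamicLimit.Theorems.KiferCompactification

/-- The uniform law on `(0, h]`, `U = (ofReal h⁻¹) • Leb|_(0,h]`, is a probability measure for `h > 0`. -/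
private theorem isProbabilityMeasure_uniformIoc (h : ℝ) (hh : 0 < h) :
    IsProbabilityMeasure ((ENNReal.ofReal h⁻¹) • (volume.restrict (Set.Ioc (0 : ℝ) h))) := by
  refine ⟨?_⟩
  rw [Measure.smul_apply, Measure.restrict_apply_univ, Real.volume_Ioc, sub_zero, smul_eq_mul,
    ← ENNReal.ofReal_mul (inv_nonneg.2 hh.le), inv_mul_cancel₀ hh.ne', ENNReal.ofReal_one]

/-- Integration against the uniform law on `(0, h]` is the normalised interval integral:
`∫ g dU = h⁻¹ ∫₀ʰ g`. -/
private theorem integral_uniformIoc (h : ℝ) (hh : 0 < h) (g : ℝ → ℝ) :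
    ∫ t, g t ∂((ENNReal.ofReal h⁻¹) • (volume.restrict (Set.Ioc (0 : ℝ) h))) =
      h⁻¹ * ∫ t in (0 : ℝ)..h, g t := by
  rw [integral_smul_measure, intervalIntegral.integral_of_le hh.le,
    ENNReal.toReal_ofReal (inv_nonneg.2 hh.le), smul_eq_mul]

/-- TIME-AVERAGED LAW (registered stub `stub_timeAveragedLaw` of line `FirstLemma`, crux
stmt-AtomisticToContinuum-14135; abstract): for a jointly measurable family `Ψ : ℝ × X → X`, a probability
law `μ` and a window `h > 0`, the time-averaged push-forward `μ̄ := Ψ_# (U ⊗ μ)`, `U` the uniform probability on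
`(0, h]`, is a probability measure with `∫ f dμ̄ = h⁻¹ ∫₀ʰ ∫ f(Ψ(t,x)) dμ dt` for bounded measurable `f`, and for
every probability law `ν` preserved by each `Ψ_t` one has `KL(μ̄ ‖ ν) ≤ KL(μ ‖ ν)` (convexity of the relative
entropy along the time average + invariance; via the two Donsker–Varadhan halves). -/
theorem stub_timeAveragedLaw {X : Type*} [MeasurableSpace X] (Ψ : ℝ × X → X) (hΨ : Measurable Ψ)
    (μ : Measure X) [IsProbabilityMeasure μ] (h : ℝ) (hh : 0 < h) :
    IsProbabilityMeasure ((((ENNReal.ofReal h⁻¹) • (volume.restrict (Set.Ioc (0 : ℝ) h))).prod μ).map Ψ) ∧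
    (∀ (f : X → ℝ) (C : ℝ), Measurable f → (∀ x, |f x| ≤ C) →
      ∫ x, f x ∂((((ENNReal.ofReal h⁻¹) • (volume.restrict (Set.Ioc (0 : ℝ) h))).prod μ).map Ψ) =
        h⁻¹ * ∫ t in (0 : ℝ)..h, ∫ x, f (Ψ (t, x)) ∂μ) ∧
    (∀ (ν : Measure X), IsProbabilityMeasure ν → (∀ t : ℝ, ν.map (fun x => Ψ (t, x)) = ν) →
      InformationTheory.klDiv ((((ENNReal.ofReal h⁻¹) • (volume.restrict (Set.Ioc (0 : ℝ) h))).prod μ).map Ψ) ν ≤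
        InformationTheory.klDiv μ ν) := by
  haveI hU : IsProbabilityMeasure ((ENNReal.ofReal h⁻¹) • (volume.restrict (Set.Ioc (0 : ℝ) h))) :=
    isProbabilityMeasure_uniformIoc h hh
  set U : Measure ℝ := (ENNReal.ofReal h⁻¹) • (volume.restrict (Set.Ioc (0 : ℝ) h)) with hUdef
  haveI hQ : IsProbabilityMeasure ((U.prod μ).map Ψ) := Measure.isProbabilityMeasure_map hΨ.aemeasurable
  -- bounded measurable observables pulled back along `Ψ` are integrable for the product law
  have hint : ∀ (f : X → ℝ) (C : ℝ), Measurable f → (∀ x, |f x| ≤ C) →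
      Integrable (fun p => f (Ψ p)) (U.prod μ) := fun f C hf hfC =>
    Integrable.of_bound (hf.comp hΨ).aestronglyMeasurable C
      (ae_of_all _ fun p => by rw [Real.norm_eq_abs]; exact hfC (Ψ p))
  -- `∫ f dμ̄ = ∫ (∫ f (Ψ (t, x)) dμ) dU`
  have hformula : ∀ (f : X → ℝ) (C : ℝ), Measurable f → (∀ x, |f x| ≤ C) →
      ∫ x, f x ∂((U.prod μ).map Ψ) = ∫ t, ∫ x, f (Ψ (t, x)) ∂μ ∂U := by
    intro f C hf hfC
    rw [integral_map hΨ.aemeasurable hf.aestronglyMeasurable, integral_prod _ (hint f C hf hfC)]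
  refine ⟨hQ, fun f C hf hfC => ?_, fun ν hν hinv => ?_⟩
  · rw [hformula f C hf hfC, hUdef, integral_uniformIoc h hh]
  · by_cases htop : InformationTheory.klDiv μ ν = ⊤
    · rw [htop]; exact le_top
    refine le_trans (Literature.Probability.Divergences.klDiv_le_of_forall_integral_le
      (K := (InformationTheory.klDiv μ ν).toReal) fun ψ C hψ hψC => ?_) ENNReal.ofReal_toReal_le
    rw [hformula ψ C hψ hψC]
    -- pointwise in `t`: easy Donsker–Varadhan half for `ψ ∘ Ψ_t`, plus invariance of `ν` under `Ψ_t`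
    have hpt : ∀ t, ∫ x, ψ (Ψ (t, x)) ∂μ ≤
        (InformationTheory.klDiv μ ν).toReal + Real.log (∫ x, Real.exp (ψ x) ∂ν) := by
      intro t
      have hmt : Measurable fun x => Ψ (t, x) := hΨ.comp measurable_prodMk_left
      have h1 := Literature.Probability.Divergences.integral_le_toReal_klDiv_add_log
        (ψ := fun x => ψ (Ψ (t, x))) htop (hψ.comp hmt) (fun x => hψC (Ψ (t, x)))
      have h2 : ∫ x, Real.exp (ψ (Ψ (t, x))) ∂ν = ∫ x, Real.exp (ψ x) ∂ν := by
        calc ∫ x, Real.exp (ψ (Ψ (t, x))) ∂ν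
            = ∫ y, Real.exp (ψ y) ∂(ν.map fun x => Ψ (t, x)) :=
              (integral_map hmt.aemeasurable hψ.exp.aestronglyMeasurable).symm
          _ = ∫ x, Real.exp (ψ x) ∂ν := by rw [hinv t]
      rwa [h2] at h1
    calc ∫ t, ∫ x, ψ (Ψ (t, x)) ∂μ ∂U
        ≤ ∫ t, ((InformationTheory.klDiv μ ν).toReal + Real.log (∫ x, Real.exp (ψ x) ∂ν)) ∂U :=
          integral_mono (hint ψ C hψ hψC).integral_prod_left (integrable_const _) hpt
      _ = (InformationTheory.klDiv μ ν).toReal + Real.log (∫ x, Real.exp (ψ x) ∂ν) := by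
          rw [integral_const, smul_eq_mul, probReal_univ, one_mul]

end Summit.AtomisticToContinuum.HydrodynamicLimit.Theorems.KiferCompactification

end
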